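import Mathlib.Geometry.Manifold.Instances.Sphere
import Mathlib.Geometry.Manifold.SmoothEmbedding
import Mathlib.Topology.Sets.Opens
import Mathlib.Analysis.SpecialFunctions.Trigonometric.Deriv
import Literature.Topology.FourManifolds.Isotopy
import Literature.Topology.FourManifolds.LocallyFlat
import HarnessLib

-- provenance: harness21/H21/H21/Prelude/FourManM/Knots.lean @ a516ff0 (interim HEAD d8f2665); M5 mechanical rewrite
/-!
# Knots, 2-knots and links in spheres (trunk T-4MAN, outline C11 parts 1–4)

This prelude file of the H21 library (trunk `FourManM`, four-manifolds and knots; notion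
`knot_link_S3`) sets up the smooth category of knots:

* `Literature.SphereEmbedding k n`: a smooth (`C^∞`) embedding of the round sphere `𝕊 k` into `𝕊 n`
  (bundled map + `Manifold.IsSmoothEmbedding`), with `Literature.Knot := SphereEmbedding 1 3`
  (classical knots `S¹ ↪ S³`) and `Literature.TwoKnot := SphereEmbedding 2 4` (2-knots `S² ↪ S⁴`);
  the knot complement `Literature.Topology.FourManifolds.SphereEmbedding.complement` as an open subset of `𝕊 n`;
* the equivalence `Literature.Topology.FourManifolds.SphereEmbedding.IsIsotopic` (ambient isotopy in `𝕊 n`, i.e. *oriented*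
  knot type) and the set of knot types `Literature.Topology.FourManifolds.KnotClass`;
* standard parametrisations: `Literature.circlePoint θ = (cos θ, sin θ) : 𝕊 1`, the zero-padding
  map `Literature.Topology.FourManifolds.euclideanInclusion`, the standard inclusions `Literature.sphereInclusion k n : 𝕊 k → 𝕊 n`, the
  equator `Literature.sphereEquator n ⊆ 𝕊 (n + 1)`, the standard embeddings
  `Literature.Topology.FourManifolds.SphereEmbedding.standard`, the unknot `Literature.Topology.FourManifolds.unknot`, the reflection `Literature.Topology.FourManifolds.reflectLast`,
  mirror image and reverse of a knot, amphichirality and invertibility;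
* `Literature.Link ι`: links in `S³` with components indexed by `ι`, their ambient isotopy and
  complement.

## Sources

* D. Rolfsen, *Knots and Links*, Publish or Perish (1976), Ch. 1 (§1.A knots and knot types),
  Ch. 2 (links), Ch. 3 (§3.A complements; §3.C mirror images, reverses, amphicheiral and
  invertible knots).
* R. H. Fox, *A quick trip through knot theory*, in: Topology of 3-manifolds (1962), §1.
* M. W. Hirsch, *Differential Topology* (1976), Ch. 8 (isotopy and ambient isotopy).
* Mathlib: `Metric.sphere` with its manifold structure
  (`Mathlib.Geometry.Manifold.Instances.Sphere`), `Manifold.IsSmoothEmbedding`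
  (`Mathlib.Geometry.Manifold.SmoothEmbedding`). Mathlib has no knots, links, or embeddings of
  spheres (searched `Knot`, `Link `, `SphereEmbedding`, `unknot`). `Circle`/`Circle.exp` live
  in `ℂ`, not in `𝕊 1 ⊆ EuclideanSpace ℝ (Fin 2)`, hence `circlePoint` below. Mathlib's
  `reflection` (in a hyperplane) is a possible later route to the smoothness of `reflectLast`.
* H21: the zero-padding map `Literature.euclideanInclusion k n : 𝔼 k → 𝔼 n` and its API
  (`euclideanInclusion_apply`, `continuous_euclideanInclusion`, `norm_euclideanInclusion`) are
  reused from `Literature.Prelude.FourManM.LocallyFlat` (which imports only Mathlib), so that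
  `SliceRibbon`/`SliceKnots`, importing both files, see a single name for this map.

## Design choices

* Knots are **smooth** embeddings `𝕊 1 → 𝕊 3` of Mathlib's round spheres (subtypes of
  `EuclideanSpace ℝ (Fin (n + 1))`), matching the accepted SPC4 statement files; the smooth,
  PL and (tame) topological theories of classical knots agree.
* Knot equivalence `SphereEmbedding.IsIsotopic` is **ambient isotopy** of `𝕊 n`
  (`Literature.Topology.FourManifolds.IsAmbientIsotopic` from `Literature.Prelude.FourManM.Isotopy`); it remembers the orientation
  of both the knot and the ambient sphere (oriented knot type). Mirror image and reversal are
  provided separately (`Knot.mirror`, `Knot.reverse`).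
* `sphereInclusion k n` keeps the **first** `k + 1` coordinates and pads with zeros in the
  **last** `n - k`, so that `sphereEquator 3 = {x | x (Fin.last 4) = 0}` is the equator used in
  `H21/Statements/SPC4/Wave0.lean` (`mem_sphereEquator_iff`).
* Smoothness of the standard inclusions and of compositions with the reflection `reflectLast`
  are named facts (`def … : Prop`; `Manifold.IsSmoothEmbedding.comp` is still a Mathlib TODO),
  bundled in the `Prop`-valued class `SphereEmbedding.SmoothnessFacts`; the definitions using
  them (`SphereEmbedding.standard`, `unknot`, `Knot.mirror`, `Knot.reverse`) take
  `[SmoothnessFacts]`. Likewise symmetry/transitivity of isotopy are named facts bundled in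
  `SphereEmbedding.IsotopyFacts k n` / `Link.IsotopyFacts ι`, consumed by
  `equivalence_isIsotopic` and `KnotClass.mk_eq_mk_iff` (M5 migration, D-0014).
* Notation `𝔼 n`, `𝕊 n` is local, exactly as in the SPC4 statement files.
-/

open scoped Manifold ContDiff Topology
open Function Set

noncomputable section

namespace Literature.Topology.FourManifolds

/-- Local notation: `𝔼 n` is the model Euclidean space `EuclideanSpace ℝ (Fin n)`. -/
local notation "𝔼 " n:arg => EuclideanSpace ℝ (Fin n)

/-- Local notation: `𝕊 n` is the unit sphere in `EuclideanSpace ℝ (Fin (n + 1))`, the standard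
`n`-sphere with its Mathlib manifold structure. -/
local notation "𝕊 " n:arg => (Metric.sphere (0 : EuclideanSpace ℝ (Fin (n + 1))) 1)

/-! ## Smooth embeddings of spheres in spheres -/

/-- A **smooth embedding of the `k`-sphere in the `n`-sphere**: a map `𝕊 k → 𝕊 n` which is a
`C^∞` embedding (immersion + topological embedding) for the round smooth structures. For
`(k, n) = (1, 3)` these are (smooth, oriented, parametrised) knots, for `(2, 4)` 2-knots.
Rolfsen, *Knots and Links* (1976), §1.A; Fox (1962), §1. [cite: Fox1962] -/
@[ext]
structure SphereEmbedding (k n : ℕ) where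
  /-- The underlying map `𝕊 k → 𝕊 n`. -/
  toFun : 𝕊 k → 𝕊 n
  /-- The map is a `C^∞` embedding. -/
  isSmoothEmbedding : Manifold.IsSmoothEmbedding (𝓡 k) (𝓡 n) ∞ toFun

/-- A (smooth, parametrised, oriented) **knot**: a smooth embedding `S¹ ↪ S³`.
Rolfsen (1976), §1.A. [cite: Rolfsen1976] -/
abbrev Knot : Type := SphereEmbedding 1 3

/-- A (smooth) **2-knot**: a smooth embedding `S² ↪ S⁴`. Rolfsen (1976), §1.A, §3.J. [cite: Rolfsen1976] -/
abbrev TwoKnot : Type := SphereEmbedding 2 4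

namespace SphereEmbedding

variable {k n : ℕ}

/-- Sphere embeddings are functions `𝕊 k → 𝕊 n`. [folklore] -/
instance instFunLike : FunLike (SphereEmbedding k n) (𝕊 k) (𝕊 n) where
  coe := toFun
  coe_injective K K' h := by cases K; cases K'; congr

/-- The coercion to a function is the field `toFun`. [folklore] -/
@[simp]
theorem toFun_eq_coe (K : SphereEmbedding k n) : K.toFun = ⇑K := rfl

/-- A sphere embedding is continuous. [folklore] -/
protected theorem continuous (K : SphereEmbedding k n) : Continuous K :=
  K.isSmoothEmbedding.isEmbedding.continuous

/-- A sphere embedding is injective. [folklore] -/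
protected theorem injective (K : SphereEmbedding k n) : Injective K :=
  K.isSmoothEmbedding.isEmbedding.injective

/-- A sphere embedding is a topological embedding. [folklore] -/
theorem isEmbedding (K : SphereEmbedding k n) : Topology.IsEmbedding K :=
  K.isSmoothEmbedding.isEmbedding

/-- A sphere embedding is `C^∞`. [folklore] -/
protected theorem contMDiff (K : SphereEmbedding k n) : ContMDiff (𝓡 k) (𝓡 n) ∞ K :=
  K.isSmoothEmbedding.contMDiff

/-- The image of a sphere embedding is compact. [folklore] -/
theorem isCompact_range (K : SphereEmbedding k n) : IsCompact (range K) :=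
  _root_.isCompact_range K.continuous

/-- The image of a sphere embedding is closed. [folklore] -/
theorem isClosed_range (K : SphereEmbedding k n) : IsClosed (range K) :=
  K.isCompact_range.isClosed

/-- The **complement** `𝕊 n ∖ K(𝕊 k)` of a sphere embedding, as an open subset of `𝕊 n` (hence
an open submanifold). Rolfsen (1976), §3.A. [cite: Rolfsen1976] -/
def complement (K : SphereEmbedding k n) : TopologicalSpace.Opens (𝕊 n) :=
  ⟨(range K)ᶜ, K.isClosed_range.isOpen_compl⟩

/-- Membership in the complement. [folklore] -/
@[simp]
theorem mem_complement_iff (K : SphereEmbedding k n) (x : 𝕊 n) :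
    x ∈ K.complement ↔ x ∉ range K := Iff.rfl

/-- In positive codimension the complement of a sphere embedding is nonempty (the image of a
smooth map from a lower-dimensional manifold has measure zero, Sard; or invariance of domain).
Hirsch (1976), Ch. 3, Thm. 1.3 / Prop. 1.2. [cite: Hirsch1976] -/
def nonempty_complement : Prop :=
  ∀ (K : SphereEmbedding k n) (h : k < n),
    Nonempty K.complement

/-! ## Knot types: ambient isotopy -/

/-- Two sphere embeddings `K K' : 𝕊 k → 𝕊 n` are **isotopic** (have the same oriented knot type)
if they are ambient isotopic in `𝕊 n`: `K' = F 1 ∘ K` for an ambient isotopy `F` of `𝕊 n`.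
By the isotopy extension theorem this is the same as smooth isotopy of embeddings
(`Literature.Topology.FourManifolds.isSmoothlyIsotopic_iff_isAmbientIsotopic`). Rolfsen (1976), §1.A; Hirsch (1976), §8.1. [cite: Rolfsen1976] -/
def IsIsotopic (K K' : SphereEmbedding k n) : Prop :=
  IsAmbientIsotopic (𝓡 k) (𝓡 n) ⇑K ⇑K'

/-- Isotopy of sphere embeddings is reflexive. [folklore] -/
theorem IsIsotopic.refl (K : SphereEmbedding k n) : K.IsIsotopic K :=
  isAmbientIsotopic_refl ⇑K

/-- Isotopy of sphere embeddings is symmetric. Hirsch (1976), §8.1. [cite: Hirsch1976] -/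
def IsIsotopic.symm : Prop :=
  ∀ {K K' : SphereEmbedding k n} (h : K.IsIsotopic K'),
    K'.IsIsotopic K

/- interim proof relied on results that are now named facts (D-0014); demoted to a fact by the M5 import, proof preserved:
:=
  IsAmbientIsotopic.symm h
-/

/-- Isotopy of sphere embeddings is transitive. Hirsch (1976), §8.1. [cite: Hirsch1976] -/
def IsIsotopic.trans : Prop :=
  ∀ {K K' K'' : SphereEmbedding k n} (h : K.IsIsotopic K') (h' : K'.IsIsotopic K''),
    K.IsIsotopic K''

/- interim proof relied on results that are now named facts (D-0014); demoted to a fact by the M5 import, proof preserved: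
:=
  IsAmbientIsotopic.trans h h'
-/

variable (k n) in
/-- The named isotopy facts of sphere embeddings `𝕊 k → 𝕊 n` whose proofs are deferred
(symmetry and transitivity of ambient isotopy: isotopy extension for the reversed and the
concatenated diffeotopy, `Isotopy.lean`), bundled as a `Prop`-valued class so that knot types
below consume them as one instance hypothesis `[IsotopyFacts k n]`. Hirsch (1976), §8.1. [cite: Hirsch1976, §8.1] -/
class IsotopyFacts : Prop where
  /-- `IsIsotopic.symm`. -/
  symm : IsIsotopic.symm (k := k) (n := n)
  /-- `IsIsotopic.trans`. -/
  trans : IsIsotopic.trans (k := k) (n := n)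

variable (k n) in
/-- Isotopy (ambient isotopy in `𝕊 n`) is an equivalence relation on sphere embeddings
(from the facts `[IsotopyFacts k n]` and the proved reflexivity). Hirsch (1976), §8.1. [cite: Hirsch1976, §8.1] -/
theorem equivalence_isIsotopic [IsotopyFacts k n] : Equivalence (IsIsotopic (k := k) (n := n)) :=
  ⟨IsIsotopic.refl, fun h ↦ IsotopyFacts.symm h, fun h h' ↦ IsotopyFacts.trans h h'⟩

/-- Isotopic sphere embeddings are smoothly isotopic as maps `𝕊 k → 𝕊 n`. [folklore] -/
def IsIsotopic.isSmoothlyIsotopic : Prop :=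
  ∀ {K K' : SphereEmbedding k n} (h : K.IsIsotopic K'),
    IsSmoothlyIsotopic (𝓡 k) (𝓡 n) ⇑K ⇑K'

/- interim proof relied on results that are now named facts (D-0014); demoted to a fact by the M5 import, proof preserved:
:=
  IsAmbientIsotopic.isSmoothlyIsotopic K.isSmoothEmbedding h
-/

end SphereEmbedding

/-- The set of (oriented) **knot types**: knots modulo ambient isotopy of `S³`.
Rolfsen (1976), §1.A. [cite: Rolfsen1976] -/
def KnotClass : Type :=
  Quot (SphereEmbedding.IsIsotopic (k := 1) (n := 3))

/-- The knot type of a knot. [folklore] -/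
def KnotClass.mk (K : Knot) : KnotClass :=
  Quot.mk _ K

/-- Two knots have the same knot type iff they are isotopic. [folklore] -/
theorem KnotClass.mk_eq_mk_iff [SphereEmbedding.IsotopyFacts 1 3] {K K' : Knot} :
    KnotClass.mk K = KnotClass.mk K' ↔ K.IsIsotopic K' :=
  ⟨fun h ↦ (SphereEmbedding.equivalence_isIsotopic 1 3).eqvGen_iff.mp (Quot.eqvGen_exact h),
    fun h ↦ Quot.sound h⟩

/-- Every knot type is the type of a knot. [folklore] -/
theorem KnotClass.mk_surjective : Surjective KnotClass.mk :=
  Quot.mk_surjective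

/-! ## Standard parametrisations and embeddings -/

/-- The point `(cos θ, sin θ)` of the unit circle `𝕊 1 ⊆ ℝ²`. Standard. (Used for Gauss
diagrams and for framings of tubular neighbourhoods downstream.) [folklore] -/
def circlePoint (θ : ℝ) : 𝕊 1 :=
  ⟨WithLp.toLp 2 ![Real.cos θ, Real.sin θ], by
    simp [EuclideanSpace.norm_eq, Fin.sum_univ_two]⟩

/-- Coordinates of `circlePoint θ`: the first coordinate is `cos θ`. [folklore] -/
@[simp]
theorem circlePoint_apply_zero (θ : ℝ) : (circlePoint θ : 𝔼 2) 0 = Real.cos θ := rfl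

/-- Coordinates of `circlePoint θ`: the second coordinate is `sin θ`. [folklore] -/
@[simp]
theorem circlePoint_apply_one (θ : ℝ) : (circlePoint θ : 𝔼 2) 1 = Real.sin θ := rfl

/-- `circlePoint` is `2π`-periodic. [folklore] -/
theorem circlePoint_add_two_pi (θ : ℝ) : circlePoint (θ + 2 * Real.pi) = circlePoint θ := by
  apply Subtype.ext
  simp [circlePoint]

/-- `circlePoint` is periodic with period `2π`. [folklore] -/
theorem periodic_circlePoint : Periodic circlePoint (2 * Real.pi) :=
  circlePoint_add_two_pi

/-- `θ ↦ circlePoint θ` is `C^∞` as a map `ℝ → ℝ²`. [folklore] -/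
theorem contDiff_coe_circlePoint : ContDiff ℝ ∞ (fun θ ↦ ((circlePoint θ : 𝕊 1) : 𝔼 2)) := by
  rw [contDiff_euclidean]
  intro i
  fin_cases i
  · simpa using Real.contDiff_cos
  · simpa using Real.contDiff_sin

/-- `circlePoint` is continuous. [folklore] -/
@[continuity, fun_prop]
theorem continuous_circlePoint : Continuous circlePoint :=
  contDiff_coe_circlePoint.continuous.subtype_mk _

/-- `circlePoint` is surjective: every point of `𝕊 1` is `(cos θ, sin θ)` for some `θ`. [folklore] -/
theorem circlePoint_surjective : Surjective circlePoint := by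
  intro x
  -- view `x` as the unit complex number `z = x₀ + i x₁` and take `θ = arg z`
  have hx := norm_eq_of_mem_sphere x
  rw [EuclideanSpace.norm_eq, Fin.sum_univ_two, Real.norm_eq_abs, Real.norm_eq_abs, sq_abs,
    sq_abs] at hx
  have hz : ‖(⟨(x : 𝔼 2) 0, (x : 𝔼 2) 1⟩ : ℂ)‖ = 1 := by
    rw [Complex.norm_def, Complex.normSq_mk]
    refine Eq.trans ?_ hx
    ring_nf
  have hz0 : (⟨(x : 𝔼 2) 0, (x : 𝔼 2) 1⟩ : ℂ) ≠ 0 := by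
    intro h; rw [h] at hz; simp at hz
  refine ⟨Complex.arg ⟨(x : 𝔼 2) 0, (x : 𝔼 2) 1⟩, Subtype.ext ?_⟩
  ext i
  fin_cases i
  · simp [Complex.cos_arg hz0, hz]
  · simp [Complex.sin_arg, hz]

/-- The **standard inclusion** `𝕊 k → 𝕊 n` (`k ≤ n`): keep the first `k + 1` coordinates and
pad with zeros in the last `n - k` coordinates. Its image is the standard great `k`-sphere
`𝕊 n ∩ (ℝ^{k+1} × {0})`. Standard; Rolfsen (1976), §1.A (the unknot). [cite: Rolfsen1976] -/
def sphereInclusion (k n : ℕ) (h : k ≤ n) (x : 𝕊 k) : 𝕊 n :=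
  ⟨euclideanInclusion (k + 1) (n + 1) x, by
    rw [mem_sphere_zero_iff_norm, norm_euclideanInclusion (by omega), norm_eq_of_mem_sphere x]⟩

/-- Coordinates of the standard inclusion. [folklore] -/
@[simp]
theorem coe_sphereInclusion (k n : ℕ) (h : k ≤ n) (x : 𝕊 k) :
    (sphereInclusion k n h x : 𝔼 (n + 1)) = euclideanInclusion (k + 1) (n + 1) x := rfl

/-- The standard inclusion of spheres is injective. [folklore] -/
theorem sphereInclusion_injective (k n : ℕ) (h : k ≤ n) : Injective (sphereInclusion k n h) := by
  intro x y hxy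
  have hxy' := congrArg (fun z : 𝕊 n ↦ (z : 𝔼 (n + 1))) hxy
  simp only [coe_sphereInclusion] at hxy'
  apply Subtype.ext
  ext i
  have := congrArg (fun z : 𝔼 (n + 1) ↦ z ⟨i, by omega⟩) hxy'
  simpa [euclideanInclusion_apply, i.2] using this

/-- The standard inclusion of spheres is continuous. [folklore] -/
@[continuity, fun_prop]
theorem continuous_sphereInclusion (k n : ℕ) (h : k ≤ n) : Continuous (sphereInclusion k n h) :=
  ((continuous_euclideanInclusion (k + 1) (n + 1)).comp continuous_subtype_val).subtype_mk _

/-- The standard inclusion `𝕊 k → 𝕊 n` (`k ≤ n`) is a smooth embedding: it is the restriction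
of a linear isometry, smooth by `ContMDiff.codRestrict_sphere`/`contMDiff_coe_sphere`, an
immersion, and a closed embedding of a compact space. Standard; Hirsch (1976), §1.3. [cite: Hirsch1976] -/
def isSmoothEmbedding_sphereInclusion : Prop :=
  ∀ {k n : ℕ} (h : k ≤ n),
    Manifold.IsSmoothEmbedding (𝓡 k) (𝓡 n) ∞ (sphereInclusion k n h)

/-- The **standard equator** `𝕊 n ⊆ 𝕊 (n + 1)`: the image of the standard inclusion, i.e. the
points whose last coordinate vanishes (`mem_sphereEquator_iff`). Standard. [folklore] -/
def sphereEquator (n : ℕ) : Set (𝕊 (n + 1)) :=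
  range (sphereInclusion n (n + 1) (Nat.le_succ n))

/-- A point of `𝕊 (n + 1)` lies on the standard equator iff its last coordinate vanishes. In
particular `sphereEquator 3` is the equator `Literature.Topology.FourManifolds.sphereFourEquator` of
`H21/Statements/SPC4/Wave0.lean`. [folklore] -/
theorem mem_sphereEquator_iff {n : ℕ} (x : 𝕊 (n + 1)) :
    x ∈ sphereEquator n ↔ (x : 𝔼 (n + 2)) (Fin.last (n + 1)) = 0 := by
  constructor
  · rintro ⟨y, rfl⟩
    simp
  · intro hx
    -- the first `n + 1` coordinates of `x`
    set y : 𝔼 (n + 1) := WithLp.toLp 2 fun i ↦ (x : 𝔼 (n + 2)) (Fin.castSucc i) with hy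
    have hpad : euclideanInclusion (n + 1) (n + 2) y = x := by
      ext i
      induction i using Fin.lastCases with
      | last => simp [hx]
      | cast i => simp [hy, i.2]
    have hnorm : ‖y‖ = 1 := by
      rw [← norm_euclideanInclusion (Nat.le_succ (n + 1)), hpad, norm_eq_of_mem_sphere x]
    exact ⟨⟨y, mem_sphere_zero_iff_norm.2 hnorm⟩, Subtype.ext hpad⟩

/-! ## Mirror image and reversal -/

/-- The **reflection in the last coordinate hyperplane**, restricted to the sphere `𝕊 n`:
`(x₀, …, xₙ₋₁, xₙ) ↦ (x₀, …, xₙ₋₁, -xₙ)`; an orientation-reversing involutive isometry of `𝕊 n`.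
Standard; Rolfsen (1976), §3.C. [cite: Rolfsen1976] -/
def reflectLast (n : ℕ) (x : 𝕊 n) : 𝕊 n :=
  ⟨WithLp.toLp 2 fun i ↦ if i = Fin.last n then -(x : 𝔼 (n + 1)) i else (x : 𝔼 (n + 1)) i, by
    have hx := norm_eq_of_mem_sphere x
    rw [EuclideanSpace.norm_eq] at hx
    rw [mem_sphere_zero_iff_norm, EuclideanSpace.norm_eq]
    refine Eq.trans ?_ hx
    congr 1
    refine Finset.sum_congr rfl fun i _ ↦ ?_
    rw [PiLp.toLp_apply]
    split_ifs <;> simp⟩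

/-- Coordinates of the reflection: the last coordinate is negated. [folklore] -/
@[simp]
theorem reflectLast_apply_last (n : ℕ) (x : 𝕊 n) :
    (reflectLast n x : 𝔼 (n + 1)) (Fin.last n) = -(x : 𝔼 (n + 1)) (Fin.last n) := by
  simp [reflectLast]

/-- Coordinates of the reflection: the other coordinates are unchanged. [folklore] -/
@[simp]
theorem reflectLast_apply_of_ne_last (n : ℕ) (x : 𝕊 n) {i : Fin (n + 1)} (hi : i ≠ Fin.last n) :
    (reflectLast n x : 𝔼 (n + 1)) i = (x : 𝔼 (n + 1)) i := by
  simp [reflectLast, hi]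

/-- The reflection is an involution. [folklore] -/
@[simp]
theorem reflectLast_reflectLast (n : ℕ) (x : 𝕊 n) : reflectLast n (reflectLast n x) = x := by
  apply Subtype.ext
  ext i
  by_cases hi : i = Fin.last n
  · subst hi; simp
  · simp [hi]

/-- The reflection is an involution. [folklore] -/
theorem involutive_reflectLast (n : ℕ) : Involutive (reflectLast n) :=
  reflectLast_reflectLast n

/-- The reflection is continuous. [folklore] -/
@[continuity, fun_prop]
theorem continuous_reflectLast (n : ℕ) : Continuous (reflectLast n) := by
  refine Continuous.subtype_mk ?_ _
  refine (PiLp.continuous_toLp 2 _).comp (continuous_pi fun i ↦ ?_)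
  split_ifs
  · exact ((PiLp.continuous_apply 2 _ i).comp continuous_subtype_val).neg
  · exact (PiLp.continuous_apply 2 _ i).comp continuous_subtype_val

/-- Post-composing a sphere embedding with the reflection of the target sphere gives a sphere
embedding (the reflection is a diffeomorphism of `𝕊 n`; uses `Manifold.IsSmoothEmbedding.comp`,
a Mathlib TODO). A possible proof route: `reflectLast n` is the restriction to the sphere of
Mathlib's `reflection` in the hyperplane `(ℝ ∙ EuclideanSpace.single (Fin.last n) 1)ᗮ`, a
linear isometry, hence smooth by `ContMDiff.codRestrict_sphere`. Hirsch (1976), §1.3. [cite: Hirsch1976] -/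
def isSmoothEmbedding_reflectLast_comp : Prop :=
  ∀ {k n : ℕ} (K : SphereEmbedding k n),
    Manifold.IsSmoothEmbedding (𝓡 k) (𝓡 n) ∞ (reflectLast n ∘ K)

/-- Pre-composing a sphere embedding with the reflection of the source sphere gives a sphere
embedding (the reflection is a diffeomorphism of `𝕊 k`; uses `Manifold.IsSmoothEmbedding.comp`,
a Mathlib TODO). Hirsch (1976), §1.3. [cite: Hirsch1976] -/
def isSmoothEmbedding_comp_reflectLast : Prop :=
  ∀ {k n : ℕ} (K : SphereEmbedding k n),
    Manifold.IsSmoothEmbedding (𝓡 k) (𝓡 n) ∞ (K ∘ reflectLast k)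

namespace SphereEmbedding

/-- The named smoothness facts of this file whose proofs are deferred (smoothness of the standard
inclusions `𝕊 k → 𝕊 n` and of compositions of sphere embeddings with the reflection
`reflectLast`; they need `Manifold.IsSmoothEmbedding.comp`, a Mathlib TODO), bundled as a
`Prop`-valued class so that the constructions `standard`, `unknot`, `mirror`, `reverse` consume
them as one instance hypothesis `[SmoothnessFacts]`. Hirsch (1976), §1.3. [cite: Hirsch1976, §1.3] -/
class SmoothnessFacts : Prop where
  /-- `isSmoothEmbedding_sphereInclusion`. -/
  sphereInclusion : isSmoothEmbedding_sphereInclusion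
  /-- `isSmoothEmbedding_reflectLast_comp`. -/
  reflectLast_comp : isSmoothEmbedding_reflectLast_comp
  /-- `isSmoothEmbedding_comp_reflectLast`. -/
  comp_reflectLast : isSmoothEmbedding_comp_reflectLast

end SphereEmbedding

/-! ## Standard embeddings and the unknot -/

namespace SphereEmbedding

/-- The **standard embedding** `𝕊 k ↪ 𝕊 n` (`k ≤ n`), the standard inclusion as a bundled
sphere embedding; for `(k, n) = (1, 3)` the unknot, for `(2, 4)` the unknotted 2-sphere.
Relies on: the named fact `isSmoothEmbedding_sphereInclusion` (via `[SmoothnessFacts]`).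
Rolfsen (1976), §1.A. [cite: Rolfsen1976, §1.A] -/
def standard [SmoothnessFacts] (k n : ℕ) (h : k ≤ n) : SphereEmbedding k n :=
  ⟨sphereInclusion k n h, SmoothnessFacts.sphereInclusion h⟩

/-- The standard embedding is the standard inclusion. [folklore] -/
@[simp]
theorem coe_standard [SmoothnessFacts] (k n : ℕ) (h : k ≤ n) : ⇑(standard k n h) = sphereInclusion k n h := rfl

/-- The image of the standard embedding `𝕊 n ↪ 𝕊 (n + 1)` is the standard equator. [folklore] -/
theorem range_standard_eq_sphereEquator [SmoothnessFacts] (n : ℕ) :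
    range (standard n (n + 1) (Nat.le_succ n)) = sphereEquator n := rfl

end SphereEmbedding

/-- The **unknot** (trivial knot): the standard great circle `𝕊 1 ↪ 𝕊 3`,
`(x₀, x₁) ↦ (x₀, x₁, 0, 0)`. Relies on: the named fact `isSmoothEmbedding_sphereInclusion`
(via `[SphereEmbedding.SmoothnessFacts]`). Rolfsen (1976), §1.A. [cite: Rolfsen1976, §1.A] -/
def unknot [SphereEmbedding.SmoothnessFacts] : Knot :=
  SphereEmbedding.standard 1 3 (by norm_num)

/-- A knot is **unknotted** (trivial) if it is isotopic to the unknot. Rolfsen (1976), §1.A. [cite: Rolfsen1976] -/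
def Knot.IsUnknot [SphereEmbedding.SmoothnessFacts] (K : Knot) : Prop :=
  K.IsIsotopic unknot

/-- The unknot is unknotted. [folklore] -/
theorem isUnknot_unknot [SphereEmbedding.SmoothnessFacts] : unknot.IsUnknot :=
  SphereEmbedding.IsIsotopic.refl _

namespace SphereEmbedding

variable {k n : ℕ} [SmoothnessFacts]

/-- The **mirror image** of a sphere embedding: compose with the reflection of the ambient
sphere `𝕊 n` in its last coordinate. Relies on: the named fact `isSmoothEmbedding_reflectLast_comp`
(via `[SmoothnessFacts]`). Rolfsen (1976), §3.C ("obverse", mirror image). [cite: Rolfsen1976, §3.C] -/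
def mirror (K : SphereEmbedding k n) : SphereEmbedding k n :=
  ⟨reflectLast n ∘ K, SmoothnessFacts.reflectLast_comp K⟩

/-- The **reverse** of a sphere embedding: precompose with the reflection of the source sphere
`𝕊 k` (reverses the orientation of the knot). Relies on: the named fact
`isSmoothEmbedding_comp_reflectLast` (via `[SmoothnessFacts]`). Rolfsen (1976), §3.C ("reverse"). [cite: Rolfsen1976, §3.C] -/
def reverse (K : SphereEmbedding k n) : SphereEmbedding k n :=
  ⟨K ∘ reflectLast k, SmoothnessFacts.comp_reflectLast K⟩

/-- The mirror image as a function. [folklore] -/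
@[simp]
theorem coe_mirror (K : SphereEmbedding k n) : ⇑K.mirror = reflectLast n ∘ K := rfl

/-- The reverse as a function. [folklore] -/
@[simp]
theorem coe_reverse (K : SphereEmbedding k n) : ⇑K.reverse = K ∘ reflectLast k := rfl

/-- Taking the mirror image twice gives back the embedding. [folklore] -/
@[simp]
theorem mirror_mirror (K : SphereEmbedding k n) : K.mirror.mirror = K := by
  ext x : 2
  simp

/-- Reversing twice gives back the embedding. [folklore] -/
@[simp]
theorem reverse_reverse (K : SphereEmbedding k n) : K.reverse.reverse = K := by
  ext x : 2
  simp

/-- Mirror image and reversal commute. [folklore] -/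
theorem mirror_reverse (K : SphereEmbedding k n) : K.reverse.mirror = K.mirror.reverse := rfl

end SphereEmbedding

namespace Knot

variable [SphereEmbedding.SmoothnessFacts]

/-- The mirror image `K.mirror` of a knot (dot notation on `Knot`). Rolfsen (1976), §3.C. [cite: Rolfsen1976] -/
abbrev mirror (K : Knot) : Knot := SphereEmbedding.mirror K

/-- The reverse `K.reverse` of a knot (dot notation on `Knot`). Rolfsen (1976), §3.C. [cite: Rolfsen1976] -/
abbrev reverse (K : Knot) : Knot := SphereEmbedding.reverse K

/-- A knot is **(positively) amphichiral** if it is isotopic, as an *oriented* knot, to its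
mirror image (`IsIsotopic` is the oriented knot type). Rolfsen's unoriented "amphicheiral"
(1976, §3.C) is `K.IsAmphichiral ∨ K.IsNegativeAmphichiral`. E.g. the figure-eight knot is
(both positively and negatively) amphichiral, the trefoil is neither (Dehn 1914). [cite: Dehn1914] -/
def IsAmphichiral (K : Knot) : Prop :=
  K.IsIsotopic K.mirror

/-- A knot is **negatively amphichiral** if it is isotopic, as an oriented knot, to the reverse
of its mirror image. Rolfsen (1976), §3.C (unoriented amphicheirality is
`IsAmphichiral ∨ IsNegativeAmphichiral`). [cite: Rolfsen1976] -/
def IsNegativeAmphichiral (K : Knot) : Prop :=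
  K.IsIsotopic K.mirror.reverse

/-- A knot is **invertible** if it is isotopic to its reverse. Rolfsen (1976), §3.C; the first
non-invertible knot (`8₁₇`) is due to Trotter (1963). [cite: Rolfsen1976] -/
def IsInvertible (K : Knot) : Prop :=
  K.IsIsotopic K.reverse

end Knot

/-! ## Links -/

/-- A (smooth, oriented, ordered) **link** in `S³` with components indexed by `ι`: a family of
knots with pairwise disjoint images. Rolfsen (1976), Ch. 2, §2.A (there `ι = Fin μ`, "link of
`μ` components"). [cite: Rolfsen1976] -/
structure Link (ι : Type*) where
  /-- The components of the link. -/
  component : ι → Knot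
  /-- Distinct components have disjoint images. -/
  disjoint : Pairwise fun i j ↦ Disjoint (range (component i)) (range (component j))

namespace Link

variable {ι : Type*}

/-- Two links (with the same index type) are **isotopic** if one ambient isotopy of `S³` carries
each component of the first to the corresponding component of the second (ordered, oriented
link type). Rolfsen (1976), §2.A; Hirsch (1976), §8.1. [cite: Rolfsen1976] -/
def IsIsotopic (L L' : Link ι) : Prop :=
  ∃ F : AmbientIsotopy (𝓡 3) (𝕊 3), ∀ i, F.toFun 1 ∘ L.component i = L'.component i

/-- Isotopy of links is reflexive. [folklore] -/
theorem IsIsotopic.refl (L : Link ι) : L.IsIsotopic L :=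
  ⟨.refl, fun _ ↦ rfl⟩

/-- Isotopy of links is symmetric (invert the ambient isotopy: isotopy extension applied to the
reversed diffeotopy, cf. `Literature.Topology.FourManifolds.IsAmbientIsotopic.symm`). Hirsch (1976), §8.1. [cite: Hirsch1976] -/
def IsIsotopic.symm : Prop :=
  ∀ {L L' : Link ι} (h : L.IsIsotopic L'),
    L'.IsIsotopic L

/-- Isotopy of links is transitive (concatenate ambient isotopies after reparametrising to be
stationary near the endpoints, cf. `Literature.Topology.FourManifolds.IsAmbientIsotopic.trans`). Hirsch (1976), §8.1. [cite: Hirsch1976] -/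
def IsIsotopic.trans : Prop :=
  ∀ {L L' L'' : Link ι} (h : L.IsIsotopic L') (h' : L'.IsIsotopic L''),
    L.IsIsotopic L''

variable (ι) in
/-- The named isotopy facts of links whose proofs are deferred (symmetry, transitivity), bundled
as a `Prop`-valued class `[Link.IsotopyFacts ι]`. Hirsch (1976), §8.1. [cite: Hirsch1976, §8.1] -/
class IsotopyFacts : Prop where
  /-- `Link.IsIsotopic.symm`. -/
  symm : IsIsotopic.symm (ι := ι)
  /-- `Link.IsIsotopic.trans`. -/
  trans : IsIsotopic.trans (ι := ι)

variable (ι) in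
/-- Isotopy of links is an equivalence relation (from the facts `[Link.IsotopyFacts ι]` and the
proved reflexivity). Hirsch (1976), §8.1. [cite: Hirsch1976, §8.1] -/
theorem equivalence_isIsotopic [IsotopyFacts ι] : Equivalence (IsIsotopic (ι := ι)) :=
  ⟨IsIsotopic.refl, fun h ↦ IsotopyFacts.symm h, fun h h' ↦ IsotopyFacts.trans h h'⟩

/-- Isotopic links have isotopic components. [folklore] -/
theorem IsIsotopic.isIsotopic_component {L L' : Link ι} (h : L.IsIsotopic L') (i : ι) :
    (L.component i).IsIsotopic (L'.component i) := by
  obtain ⟨F, hF⟩ := h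
  exact ⟨F, hF i⟩

/-- The one-component link of a knot. Rolfsen (1976), §2.A. [cite: Rolfsen1976] -/
def ofKnot (K : Knot) : Link Unit where
  component _ := K
  disjoint i j h := absurd (Subsingleton.elim i j) h

/-- The component of `Link.ofKnot K` is `K`. [folklore] -/
@[simp]
theorem ofKnot_component (K : Knot) (i : Unit) : (ofKnot K).component i = K := rfl

/-- One-component links are isotopic iff their knots are. [folklore] -/
theorem ofKnot_isIsotopic_ofKnot_iff {K K' : Knot} :
    (ofKnot K).IsIsotopic (ofKnot K') ↔ K.IsIsotopic K' :=
  ⟨fun h ↦ h.isIsotopic_component (), fun ⟨F, hF⟩ ↦ ⟨F, fun _ ↦ hF⟩⟩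

/-- The union of the images of the components of a link. [folklore] -/
def carrier (L : Link ι) : Set (𝕊 3) :=
  ⋃ i, range (L.component i)

/-- Membership in the carrier of a link. [folklore] -/
@[simp]
theorem mem_carrier_iff (L : Link ι) (x : 𝕊 3) :
    x ∈ L.carrier ↔ ∃ i, x ∈ range (L.component i) := mem_iUnion

/-- The carrier of a link with finitely many components is closed. [folklore] -/
theorem isClosed_carrier [Finite ι] (L : Link ι) : IsClosed L.carrier :=
  isClosed_iUnion_of_finite fun i ↦ (L.component i).isClosed_range

/-- The **complement** of a link with finitely many components, an open subset of `S³`.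
Rolfsen (1976), §3.A. [cite: Rolfsen1976] -/
def complement [Finite ι] (L : Link ι) : TopologicalSpace.Opens (𝕊 3) :=
  ⟨L.carrierᶜ, L.isClosed_carrier.isOpen_compl⟩

/-- Membership in the complement of a link. [folklore] -/
@[simp]
theorem mem_complement_iff [Finite ι] (L : Link ι) (x : 𝕊 3) :
    x ∈ L.complement ↔ ∀ i, x ∉ range (L.component i) := by
  simp [complement, carrier]

/-- The complement of a one-component link is the knot complement. [folklore] -/
@[simp]
theorem complement_ofKnot (K : Knot) : (ofKnot K).complement = K.complement := by
  ext x
  simp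

end Link

end Literature.Topology.FourManifolds

/-! ## Discharge (D-0014): symmetry of isotopy of links

Isotopy of links is ambient isotopy in `𝕊 3`, so symmetry is the reversed ambient isotopy
`AmbientIsotopy.reverse` (`t ↦ F (1 - t) ∘ (F 1)⁻¹`) of `Isotopy.lean`, applied to every
component at once; Hirsch, *Differential Topology* (1976), Ch. 8, §8.1, p. 178 (isotopy and
ambient isotopy are equivalence relations). -/

namespace Literature.Topology.FourManifolds

namespace Link

variable {ι : Type*}

/-- Isotopy of links is symmetric: if `F 1 ∘ Lᵢ = L'ᵢ` for all `i`, then the reversed ambient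
isotopy `F.reverse` (`t ↦ F (1 - t) ∘ (F 1)⁻¹`) satisfies `F.reverse 1 ∘ L'ᵢ = Lᵢ` for all `i`.
Hirsch (1976), §8.1, p. 178. [cite: Hirsch1976, §8.1] -/
theorem IsIsotopic.symm' {L L' : Link ι} (h : L.IsIsotopic L') : L'.IsIsotopic L := by
  obtain ⟨F, hF⟩ := h
  refine ⟨F.reverse, fun i ↦ ?_⟩
  funext x
  rw [← hF i, F.reverse_toFun_one, Function.comp_apply, Function.comp_apply,
    ← F.coe_toDiffeomorph, Diffeomorph.symm_apply_apply]

/-- Discharge of the named fact `Link.IsIsotopic.symm`: isotopy of links is symmetric.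
Hirsch (1976), §8.1, p. 178. [cite: Hirsch1976, §8.1] -/
theorem IsIsotopic.symm_holds : IsIsotopic.symm (ι := ι) :=
  fun h ↦ h.symm'

end Link

end Literature.Topology.FourManifolds
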